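/-
Copyright (c) 2026 the pub-hodgecm-mathlib formalisation cell (harness21).  Prover seat hodgecm-mathlib-LH4-p02 (g8); FILE 2 named by dealer LH4-plan (g7) WORD #30
(2026-09-02 16:03:26Z): the equal-size sub-case left open by ★ p851957 `not_condition_four_of_ne_normForm`, T7 binder `hbδ` of LH7-p03 (g5) (WORD #15).
-/
import Literature.NumberTheory.Automorphic.UnitaryThreeBorelConjugateCongruencesTrace
import Literature.NumberTheory.Automorphic.UnitaryThreeBorelConjugateCongruencesJZeroTrace
import HarnessLib

/-!
# Flicker's fourth congruence in the trace frame: the EQUAL-SIZE case `|A − b| = |D − b|` read from the literal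

Topic `NumberTheory/Automorphic`; namespace `Literature.NumberTheory.Automorphic.UnitaryGroup`; THEOREMS ONLY (kernel lane).  Letters of ★ (C3a)
`UnitaryThreeBorelConjugateCongruencesTrace` (`(ν, w)` normal form: `E₄ = B₁ν⁻¹ + (A − b)w + (D − b)σw + νB₂·(wσw)`, `w + σw = s`, `B₁ = B₂·p`).

THE MATHEMATICS [Flicker1998UnitaryFL, Prop. 10 p. 86 «if `ν′ ≠ ν″` …», Prop. 13 p. 93 «if `N₊ < N`, `2m`, there are no solutions»].  ★ `not_condition_four_of_ne_normForm`
decides (4′) when the two linear terms have DIFFERENT sizes `|A − b| ≠ |D − b|` (isosceles).  In the trace frame the general corner has `A ≠ D` and the case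
`|A − b| = |D − b|` is the GENERIC one; it is read from the literal through the identity
**`(A − b)w + (D − b)σw = (D − b)·s + (A − D)·w`** (`s = w + σw` is a UNIT on the trace fibre: `s = −yσy`, `|y| = 1`): as soon as `|A − D| < |D − b|` — which
FORCES `|A − b| = |D − b|` — the linear form has the exact size `|D − b|`, so (4′) fails whenever `|B₂|, |t|² < |D − b|` (`|B₁ν⁻¹| = |B₂||p| ≤ |B₂|`,
`|νB₂wσw| ≤ |B₂|`): `not_condition_four_of_v_sub_sub_lt_normForm`.  The size of `A − D` is where T7 enters: in the trace literal of ★ `FlickerScalarsTraceCM`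
`A − D = c·(σb₀ − b₀)` (`c = x₁ − x₃`), and under LH7-p03's T7 `|σb₀ − b₀| = 1` (automatic at `|2| < 1`: ★ `valued_map_sub_self_eq_one_of_valued_two_lt_one`) one has
`|A − D| = |c|`: `not_condition_four_of_T7_normForm` is the head with `hbδ` leading.  The complementary equal-size situation `|(A−b)w + (D−b)σw| = |B₂|` is the
QUADRATIC-CONGRUENCE regime of ★ `condition_four_iff_quadratic_normForm` ∕ `v_sub_le_of_quadratic_normForm` (solutions exist and are counted there), and
`|D − b|, |A − D| < |B₂|` is ★ `not_condition_four_of_lt_normForm` (`v_linear_lt_of_lt`).  HONEST LABEL: count-neutral valuation algebra; HC_CM is proved only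
modulo the printed citations until rung 0 closes.

## References
* [Flicker1998UnitaryFL] Y. Z. Flicker, *Elementary proof of the fundamental lemma for a unitary group*, Canad. J. Math. 50 (1998): Prop. 10 p. 86, Prop. 13 pp. 91–93.
-/

set_option autoImplicit false

open scoped WithZero

namespace Literature.NumberTheory.Automorphic

namespace UnitaryGroup

open Literature.NumberTheory.Automorphic.HermitianLattice (UnramifiedLocalConjDatum)

variable {K : Type*} [Field K] [Valued K ℤᵐ⁰] {ϖ : K} (σ : K →+* K)

/-! ## §1 The linear form of (4′) on the trace fibre -/

omit [Valued K ℤᵐ⁰] in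
/-- `(A − b)w + (D − b)σw = (D − b)s + (A − D)w` on the trace fibre `w + σw = s`. [cite: Flicker1998UnitaryFL, Prop. 10 p. 86] -/
theorem linear_eq_mul_trace_add {A D b w w' s : K} (hws : w + w' = s) :
    (A - b) * w + (D - b) * w' = (D - b) * s + (A - D) * w := by
  rw [← hws]; ring

/-- If `|A − D| < |D − b|` then `|A − b| = |D − b|` — the equal-size case of ★ `not_condition_four_of_ne_normForm` is forced. [cite: Flicker1998UnitaryFL, Prop. 10 p. 86] -/
theorem v_sub_eq_of_v_sub_sub_lt {A D b : K} (hAD : Valued.v (A - D) < Valued.v (D - b)) : Valued.v (A - b) = Valued.v (D - b) := by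
  rw [show A - b = (D - b) + (A - D) by ring]
  exact Valuation.map_add_eq_of_lt_left _ hAD

/-- **The equal-size linear form READ**: on the trace fibre (`w + σw = s`, `|s| = 1`, `|w| ≤ 1`), `|A − D| < |D − b|` gives `|(A − b)w + (D − b)σw| = |D − b|`.
[cite: Flicker1998UnitaryFL, Prop. 10 p. 86; Prop. 13 p. 93] -/
theorem v_linear_eq_of_v_sub_sub_lt {A D b w s : K} (hws : w + σ w = s) (hs : Valued.v s = 1) (hwv : Valued.v w ≤ 1)
    (hAD : Valued.v (A - D) < Valued.v (D - b)) : Valued.v ((A - b) * w + (D - b) * σ w) = Valued.v (D - b) := by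
  rw [linear_eq_mul_trace_add hws]
  have h1 : Valued.v ((D - b) * s) = Valued.v (D - b) := by rw [map_mul, hs, mul_one]
  have h2 : Valued.v ((A - D) * w) < Valued.v ((D - b) * s) := by
    rw [h1, map_mul]; exact lt_of_le_of_lt (mul_le_mul' le_rfl hwv) (by rw [mul_one]; exact hAD)
  rw [Valuation.map_add_eq_of_lt_left _ h2, h1]

/-- Conversely, `|D − b| < ρ` and `|A − D| < ρ` give `|(A − b)w + (D − b)σw| < ρ` (the hypothesis shape of ★ `not_condition_four_of_lt_normForm` from the literal's two sizes).
[cite: Flicker1998UnitaryFL, Prop. 10 p. 86] -/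
theorem v_linear_lt_of_lt {A D b w s : K} {ρ : ℤᵐ⁰} (hws : w + σ w = s) (hs : Valued.v s = 1) (hwv : Valued.v w ≤ 1)
    (hD : Valued.v (D - b) < ρ) (hAD : Valued.v (A - D) < ρ) : Valued.v ((A - b) * w + (D - b) * σ w) < ρ := by
  rw [linear_eq_mul_trace_add hws]
  refine lt_of_le_of_lt (Valuation.map_add _ _ _) (max_lt ?_ ?_)
  · rw [map_mul, hs, mul_one]; exact hD
  · rw [map_mul]; exact lt_of_le_of_lt (mul_le_mul' le_rfl hwv) (by rw [mul_one]; exact hAD)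

/-! ## §2 The verdict: no solution in the equal-size case once `|D − b|` dominates -/

/-- **EQUAL-SIZE CASE, NO SOLUTION** (the sub-case ★ `not_condition_four_of_ne_normForm` leaves open): for a unit `ν`, `w` on the trace fibre (`w + σw = s`, `|s| = 1`,
`|w| ≤ 1`), `B₁ = B₂p` with `|p| ≤ 1`: if `|A − D| < |D − b|` (so `|A − b| = |D − b|`), `|B₂| < |D − b|` and `|t|² < |D − b|`, then (4′) fails — the linear form has
the exact size `|D − b|` and dominates `|B₁ν⁻¹|, |νB₂wσw| ≤ |B₂|`. [cite: Flicker1998UnitaryFL, Prop. 10 p. 86; Prop. 13 p. 93] -/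
theorem not_condition_four_of_v_sub_sub_lt_normForm (hd : UnramifiedLocalConjDatum σ ϖ) {A D b B₁ B₂ ν w s p : K} {m : ℕ}
    (hν : Valued.v ν = 1) (hws : w + σ w = s) (hs : Valued.v s = 1) (hwv : Valued.v w ≤ 1) (hB₁ : B₁ = B₂ * p) (hvp : Valued.v p ≤ 1)
    (hAD : Valued.v (A - D) < Valued.v (D - b)) (hB₂ : Valued.v B₂ < Valued.v (D - b))
    (hbig : Valued.v (ϖ ^ m) * Valued.v (ϖ ^ m) < Valued.v (D - b)) :
    ¬ Valued.v (B₁ * ν⁻¹ + (A - b) * w + (D - b) * σ w + ν * B₂ * (w * σ w)) ≤ Valued.v (ϖ ^ m) * Valued.v (ϖ ^ m) := by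
  intro h₄
  have hσwv : Valued.v (σ w) ≤ 1 := by rw [hd.vσ]; exact hwv
  have hlin : Valued.v ((A - b) * w + (D - b) * σ w) = Valued.v (D - b) := v_linear_eq_of_v_sub_sub_lt σ hws hs hwv hAD
  have t1 : Valued.v (B₁ * ν⁻¹) < Valued.v (D - b) := by
    rw [hB₁, map_mul, map_mul, map_inv₀, hν, inv_one, mul_one]
    exact lt_of_le_of_lt (mul_le_mul' le_rfl hvp) (by rw [mul_one]; exact hB₂)
  have t4 : Valued.v (ν * B₂ * (w * σ w)) < Valued.v (D - b) := by
    rw [map_mul, map_mul, hν, one_mul, map_mul]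
    exact lt_of_le_of_lt (mul_le_mul' le_rfl (mul_le_one' hwv hσwv)) (by rw [mul_one]; exact hB₂)
  have e : B₁ * ν⁻¹ + (A - b) * w + (D - b) * σ w + ν * B₂ * (w * σ w) = ((A - b) * w + (D - b) * σ w) + (B₁ * ν⁻¹ + ν * B₂ * (w * σ w)) := by ring
  have hsmall : Valued.v (B₁ * ν⁻¹ + ν * B₂ * (w * σ w)) < Valued.v ((A - b) * w + (D - b) * σ w) := by
    rw [hlin]; exact lt_of_le_of_lt (Valuation.map_add _ _ _) (max_lt t1 t4)
  rw [e, Valuation.map_add_eq_of_lt_left _ hsmall, hlin] at h₄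
  exact absurd (lt_of_lt_of_le hbig h₄) (lt_irrefl _)

/-- **`|B₂|` DOMINANT, from the literal's two sizes** (★ `not_condition_four_of_lt_normForm` fed by `|A − b| ≤ max(|D − b|, |A − D|)`): if `|D − b|, |A − D| < |B₂|`,
`|t|² < |B₂|`, `|wσw| = 1` and `|p| < 1`, then (4′) fails. [cite: Flicker1998UnitaryFL, Prop. 10 p. 86] -/
theorem not_condition_four_of_v_lt_B₂_normForm {A D b B₁ B₂ ν w p : K} {m : ℕ} (hB₂0 : B₂ ≠ 0) (hν : Valued.v ν = 1)
    (hwv : Valued.v w ≤ 1) (hσwv : Valued.v (σ w) ≤ 1) (hN : Valued.v (w * σ w) = 1)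
    (hB₁ : B₁ = B₂ * p) (hvp : Valued.v p < 1) (hD : Valued.v (D - b) < Valued.v B₂) (hAD : Valued.v (A - D) < Valued.v B₂)
    (hbig : Valued.v (ϖ ^ m) * Valued.v (ϖ ^ m) < Valued.v B₂) :
    ¬ Valued.v (B₁ * ν⁻¹ + (A - b) * w + (D - b) * σ w + ν * B₂ * (w * σ w)) ≤ Valued.v (ϖ ^ m) * Valued.v (ϖ ^ m) := by
  have hA : Valued.v (A - b) < Valued.v B₂ := by
    rw [show A - b = (D - b) + (A - D) by ring]; exact lt_of_le_of_lt (Valuation.map_add _ _ _) (max_lt hD hAD)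
  exact not_condition_four_of_lt_normForm σ (A := A) (D := D) (b := b) (w := w) (m := m) hB₂0 hν hwv hσwv hN hB₁ hvp (max_lt hA hD) hbig

/-! ## §3 T7 docking: the size of `A − D` from the trace literal -/

/-- **`|A − D| = |c|` under T7**: if `A − D = c·(σb₀ − b₀)` (trace literal of ★ `FlickerScalarsTraceCM`: `c = x₁ − x₃`) and `|σb₀ − b₀| = 1` (T7; automatic when `|2| < 1`
and `b₀ + σb₀ = 1`, ★ `valued_map_sub_self_eq_one_of_valued_two_lt_one`). [cite: Flicker1998UnitaryFL, Prop. 13 p. 93] -/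
theorem v_sub_sub_eq_of_T7 {A D c b₀ : K} (hbδ : Valued.v (σ b₀ - b₀) = 1) (hADc : A - D = c * (σ b₀ - b₀)) : Valued.v (A - D) = Valued.v c := by
  rw [hADc, map_mul, hbδ, mul_one]

/-- **EQUAL-SIZE CASE UNDER T7, NO SOLUTION** (`hbδ` leading; the head the (C3e)∕C4-2 counts call): for the unramified datum, `|σb₀ − b₀| = 1`, `A − D = c(σb₀ − b₀)`,
a unit `ν`, `w` on the trace fibre (`w + σw = s`, `|s| = 1`, `|w| ≤ 1`), `B₁ = B₂p` (`|p| ≤ 1`): if `|c| < |D − b|`, `|B₂| < |D − b|` and `|t|² < |D − b|` then (4′)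
fails for every such `(ν, w)`. [cite: Flicker1998UnitaryFL, Prop. 10 p. 86; Prop. 13 p. 93] -/
theorem not_condition_four_of_T7_normForm (hd : UnramifiedLocalConjDatum σ ϖ) {b₀ : K} (hbδ : Valued.v (σ b₀ - b₀) = 1)
    {A D b B₁ B₂ ν w s p c : K} {m : ℕ} (hADc : A - D = c * (σ b₀ - b₀)) (hν : Valued.v ν = 1) (hws : w + σ w = s) (hs : Valued.v s = 1)
    (hwv : Valued.v w ≤ 1) (hB₁ : B₁ = B₂ * p) (hvp : Valued.v p ≤ 1) (hc : Valued.v c < Valued.v (D - b)) (hB₂ : Valued.v B₂ < Valued.v (D - b))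
    (hbig : Valued.v (ϖ ^ m) * Valued.v (ϖ ^ m) < Valued.v (D - b)) :
    ¬ Valued.v (B₁ * ν⁻¹ + (A - b) * w + (D - b) * σ w + ν * B₂ * (w * σ w)) ≤ Valued.v (ϖ ^ m) * Valued.v (ϖ ^ m) :=
  not_condition_four_of_v_sub_sub_lt_normForm σ hd hν hws hs hwv hB₁ hvp (by rw [v_sub_sub_eq_of_T7 σ hbδ hADc]; exact hc) hB₂ hbig

/-- **The trace instance `s = −1`** (`(y, z) = (1, −b₀)`: `w = x − b₀`, `w + σw = −(b₀ + σb₀) = −1`): `|s| = 1` and the fibre relation, for docking with ★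
`borel_conj_mem_unitaryInt_iff_trace`. [cite: Flicker1998UnitaryFL, Prop. 13 p. 93] -/
theorem add_map_eq_neg_one_of_trace {x b₀ : K} (hσx : σ x = -x) (hb₀ : b₀ + σ b₀ = 1) :
    (x - b₀) + σ (x - b₀) = -1 ∧ Valued.v (-1 : K) = 1 := by
  refine ⟨?_, by rw [Valuation.map_neg, map_one]⟩
  rw [map_sub, hσx]; linear_combination (-1 : K) * hb₀

/-! ## §4 Docking lemma for the counts: the fixed part `w₀` of `z + r = κw₀ + y₀` is a unit -/

/-- **`|w₀| = 1` in every regime with `|C| < 1`** (`C = r(s + r)`; reading asked by LH4-p01 (g6) CENSUS-Large (6)): if `|κ + σκ| = 1`, `|s| = 1`, `(κ + σκ)w₀ = s + 2r` (the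
fixed part of `z + r`, ★ `exists_eq_mul_fixed_add_anti`: `(z + r) + σ(z + r) = s + 2r`) and `|r(s + r)| < 1`, then `|w₀| = 1` — uses only `|2| ≤ 1`: either `|r| < 1` and
`|s + 2r| = |s|`, or `|r| = 1 > |s + r|` and `|s + 2r| = |(s + r) + r| = |r|`. [cite: Flicker1998UnitaryFL, Prop. 13 p. 93] -/
theorem v_eq_one_of_trace_mul_eq {κ s r w₀ : K} (htr : Valued.v (κ + σ κ) = 1) (hs : Valued.v s = 1) (hw₀ : (κ + σ κ) * w₀ = s + 2 * r)
    (hC : Valued.v (r * (s + r)) < 1) : Valued.v w₀ = 1 := by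
  have h2 : Valued.v (2 : K) ≤ 1 := by
    rw [← one_add_one_eq_two]; exact le_trans (Valuation.map_add _ _ _) (by rw [map_one, max_self])
  have hv : Valued.v w₀ = Valued.v (s + 2 * r) := by rw [← hw₀, map_mul, htr, one_mul]
  rw [hv]
  by_cases hr : Valued.v r < 1
  · have h2r : Valued.v (2 * r) < Valued.v s := by
      rw [hs, map_mul]; exact lt_of_le_of_lt (mul_le_mul' h2 le_rfl) (by rw [one_mul]; exact hr)
    rw [Valuation.map_add_eq_of_lt_left _ h2r, hs]
  · have hr' : 1 ≤ Valued.v r := not_lt.1 hr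
    have hsr : Valued.v (s + r) < 1 := by
      by_contra hge
      exact absurd hC (not_lt.2 (by rw [map_mul]; exact one_le_mul hr' (not_lt.1 hge)))
    have hr1 : Valued.v r = 1 := by
      refine le_antisymm ?_ hr'
      by_contra hgt
      have hsr' : Valued.v (s + r) = Valued.v r := Valuation.map_add_eq_of_lt_right _ (by rw [hs]; exact not_le.1 hgt)
      rw [hsr'] at hsr
      exact hgt hsr.le
    rw [show s + 2 * r = (s + r) + r by ring, Valuation.map_add_eq_of_lt_right _ (by rw [hr1]; exact hsr), hr1]

end UnitaryGroup

end Literature.NumberTheory.Automorphic
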